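import Mathlib
import HarnessLib
import Literature.Combinatorics.Additive.StepBeyondKempermanReduction

/-!
# Grynkiewicz 2009, §6 Claim 5, opening: a periodic superset of `A + B` with two new elements

[cite: Grynkiewicz2009, §6 Claim 5 (proof of Thm 4.1), displays (40)–(41)] [tag: critical-pair] [tag: inverse-theorem]

Topic `Literature/Combinatorics/Additive`.  Cell `mm-stpp` (D-0046), seat `mm-stpp-lit` (gen 23); the
port of D. J. Grynkiewicz, *A step beyond Kemperman's structure theorem*, Mathematika **55** (2009)
67–114 continued.  §6, **Claim 5** («`d⊆(A + B, 𝒫) ≥ 3`», print pp. 24–26), FIRST PARAGRAPH (p. 24):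
«Suppose instead (in view of Claim 2), for some distinct `γ₁, γ₂ ∈ \overline{A + B}`, that
`(A + B) ∪ {γ₁, γ₂}` is periodic with maximal period (say) `H`.  Note that `φ_H(γᵢ) ∈ φ_H(A + B)`, for
`i = 1, 2`, since otherwise `A + B` is periodic, contradicting Claim 1.  Hence choosing
`α₁ ∈ (γ₁ − B) ∩ (H + A)` and `β₁ ∈ (γ₂ − A) ∩ (H + B)`, it follows that
`(A ∪ {α₁}) + (B ∪ {β₁}) = (A + B) ∪ {γ₁, γ₂}`.  Since `d⊆(A + B, 𝒫) ≥ 2` (Claim 2), it follows that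
either `A` or `B`, w.l.o.g. `A`, contains at least two `H`-holes.  Thus we can find
`α₂ ∈ (H + A) ∖ (A ∪ {α₁})` such that `(A ∪ {α₁, α₂}) + (B ∪ {β₁}) = (A + B) ∪ {γ₁, γ₂}` is maximally
`H`-periodic.  Hence from Kneser's Theorem it follows that there are `ρ = |H| − 1 + 3 = |H| + 2` holes
contained among the sets `A` and `B`, and that (40) `|φ_H(A + B)| = |φ_H(A)| + |φ_H(B)| − 1`.»

This file proves that paragraph as one lemma, `Grynkiewicz2009.claim5_setup`: with `H = H((A + B) ∪
{γ₁, γ₂})` (carried as the finset `Hf = ((A + B) ∪ {γ₁, γ₂}).addStab` and the subgroup `H`), it gives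
(a) `(A + B) ∪ {γ₁, γ₂} = A + B + H` («`φ_H(γᵢ) ∈ φ_H(A + B)`»), (b) the hole count
`|A + H| + |B + H| = |A| + |B| + |H| + 2` («`ρ = |H| + 2`»), (c) display (40) in coset counts, and
(d) the elements `α₁ ∈ (γ₁ − B) ∩ (H + A)`, `β₁ ∈ (γ₂ − A) ∩ (H + B)` with
`(A ∪ {α₁}) + (B ∪ {β₁}) = (A + B) ∪ {γ₁, γ₂}`.
PROOF ROUTE for (b)–(c) (a bookkeeping deviation, flagged): Kneser's theorem for the pair
`(A + H, B)` (whose sum is `(A + B) ∪ {γ₁, γ₂}`, with stabilizer `H`) gives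
`|φ_H(A)| + |φ_H(B)| ≤ |φ_H(A + B)| + 1`; counting `|A + B| + 2 = |A| + |B| + 2` inside
`|φ_H(A + B)|·|H|` shows that strict inequality would leave at most two holes in total, which is
impossible: no hole in `A` (or `B`) makes `A + B` periodic, and one hole in each of the
NON-QUASI-PERIODIC sets `A`, `B` (Claim 4) puts each inside one `H`-coset
(`sub_mem_of_card_add_eq_succ`), whence `A + B` lies in one coset while meeting `|φ_H(A)| + |φ_H(B)| = 2`
of them.  (The print obtains «at least two holes in `A` or `B`» from Claim 2 and then `ρ = |H| + 2`
from the maximally periodic critical pair `(A ∪ {α₁, α₂}, B ∪ {β₁})`; we use Claim 4 instead of Claim 2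
for the first step — both are standing assumptions at this point of §6.)
Not here: the rest of Claim 5 (the pairs `(φ_H(aᵢ), φ_H(bᵢ))`, `|H| = 2`, the cases `l = 2, 3, 4`, type
(VIII)).

MAIN RESULTS (0 definitions, 0 named facts; everything PROVED): `Grynkiewicz2009.claim5_setup`,
`sub_mem_of_card_add_eq_succ` (a non-quasi-periodic set with exactly one `H`-hole lies in one coset).

## References
* D. J. Grynkiewicz, *A step beyond Kemperman's structure theorem*, Mathematika 55 (2009) 67–114,
  doi:10.1112/S0025579300000966, §6 Claim 5 (p. 24), displays (40)–(41)
  [cite: Grynkiewicz2009, Thm 4.1 (proof, Claim 5)] — held `paper:doi-10-1112-s0025579300000966`,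
  p0024–p0025 read 2026-08-29.
-/

namespace Literature.Combinatorics.Additive

open Finset
open scoped Pointwise

universe u

variable {G : Type u} [AddCommGroup G] [DecidableEq G]

namespace Grynkiewicz2009

/-- **One hole, not quasi-periodic ⟹ one coset.**  If `A ≠ ∅` is not quasi-periodic and `A + H`
has exactly one element more than `A` (`H ≠ 0` carried as the finset `Hf`), then `A` lies inside one
`H`-coset — otherwise the full cosets of `A` form a nonempty periodic part.
[cite: Grynkiewicz2009, §2 (quasi-periodic decompositions); §6 Claim 5] -/
theorem sub_mem_of_card_add_eq_succ {A Hf : Finset G} {H : AddSubgroup G}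
    (hHf : ∀ g, g ∈ Hf ↔ g ∈ H) (hH : H ≠ ⊥) (hAqp : ¬ IsQuasiPeriodic A)
    (h1 : #(A + Hf) = #A + 1) : ∀ x ∈ A, ∀ y ∈ A, x - y ∈ H := by
  classical
  have h0 : (0 : G) ∈ Hf := (hHf 0).2 H.zero_mem
  have hsub : A ⊆ A + Hf := subset_add_left A h0
  have hcard : #((A + Hf) \ A) = 1 := by rw [card_sdiff_of_subset hsub, h1]; omega
  obtain ⟨α, hα⟩ := card_eq_one.1 hcard
  -- the full cosets of `A` and the coset of the hole
  set A₁ := A.filter fun x => x - α ∉ H with hA₁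
  set A₀ := A.filter fun x => x - α ∈ H with hA₀
  have hmemA : ∀ {x h : G}, x ∈ A → h ∈ H → h + x ∉ A → h + x = α := by
    intro x h hx hh hnot
    have : h + x ∈ (A + Hf) \ A := by
      rw [mem_sdiff]
      exact ⟨by rw [add_comm h x]; exact add_mem_add hx ((hHf h).2 hh), hnot⟩
    rw [hα, mem_singleton] at this
    exact this
  have hdec : IsQuasiPeriodicDecomp H A A₁ A₀ := by
    refine ⟨hH, ?_, ?_, ?_, ?_⟩
    · rw [hA₁, hA₀]
      exact disjoint_filter.2 fun x _ h1 h2 => h1 h2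
    · rw [hA₁, hA₀, union_comm]; exact filter_union_filter_not_eq _ A
    · intro h hh
      refine eq_of_subset_of_card_le (fun z hz => ?_) (by rw [card_vadd_finset])
      obtain ⟨x, hx, rfl⟩ := mem_vadd_finset.1 hz
      rw [hA₁, mem_filter] at hx ⊢
      rw [vadd_eq_add]
      have hxα : h + x - α ∉ H := fun hmem => hx.2 (by
        have := H.sub_mem hmem hh
        rwa [show h + x - α - h = x - α by abel] at this)
      refine ⟨?_, hxα⟩
      by_contra hnot
      have := hmemA hx.1 hh hnot
      apply hxα
      rw [this, sub_self]; exact H.zero_mem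
    · intro x hx y hy
      rw [hA₀, mem_filter] at hx hy
      have := H.sub_mem hx.2 hy.2
      rwa [show x - α - (y - α) = x - y by abel] at this
  obtain ⟨hA₁e, -⟩ := hdec.left_eq_empty_of_not_isQuasiPeriodic hAqp
  intro x hx y hy
  have hxα : x - α ∈ H := by
    by_contra hnot
    have : x ∈ A₁ := by rw [hA₁, mem_filter]; exact ⟨hx, hnot⟩
    rw [hA₁e] at this
    exact notMem_empty x this
  have hyα : y - α ∈ H := by
    by_contra hnot
    have : y ∈ A₁ := by rw [hA₁, mem_filter]; exact ⟨hy, hnot⟩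
    rw [hA₁e] at this
    exact notMem_empty y this
  have := H.sub_mem hxα hyα
  rwa [show x - α - (y - α) = x - y by abel] at this

/-- **Claim 5, opening paragraph.**  `A, B ≠ ∅` not quasi-periodic, `|A + B| = |A| + |B|`, `A + B`
aperiodic, `γ₁ ≠ γ₂ ∉ A + B` with `C' = (A + B) ∪ {γ₁, γ₂}` periodic, `H = H(C')` its (maximal) period,
nontrivial, carried as `Hf = C'.addStab` and the subgroup `H`.  Then: (a) `C' = A + B + H`
(«`φ_H(γᵢ) ∈ φ_H(A + B)`, since otherwise `A + B` is periodic»); (b) `|A + H| + |B + H| = |A| + |B| + |H| + 2`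
(«there are `ρ = |H| + 2` holes contained among the sets `A` and `B`»); (c) display (40)
`|φ_H(A + B)| + 1 = |φ_H(A)| + |φ_H(B)|`; (d) `α₁ ∈ (γ₁ − B) ∩ (H + A)`, `β₁ ∈ (γ₂ − A) ∩ (H + B)` exist, and
for any such choice `(A ∪ {α₁}) + (B ∪ {β₁}) = C'`.  Proof route in the module docstring.
[cite: Grynkiewicz2009, §6 Claim 5 (proof of Thm 4.1, p. 24), display (40)] -/
theorem claim5_setup {A B Hf : Finset G} {H : AddSubgroup G} {γ₁ γ₂ : G}
    (hHf : ∀ g, g ∈ Hf ↔ g ∈ H) (hH : H ≠ ⊥)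
    (hA : A.Nonempty) (hB : B.Nonempty) (hAB : #(A + B) = #A + #B) (haper : (A + B).addStab = {0})
    (hAqp : ¬ IsQuasiPeriodic A) (hBqp : ¬ IsQuasiPeriodic B)
    (hγ₁ : γ₁ ∉ A + B) (hγ₂ : γ₂ ∉ A + B) (hne : γ₁ ≠ γ₂)
    (hstab : (insert γ₁ (insert γ₂ (A + B))).addStab = Hf) :
    insert γ₁ (insert γ₂ (A + B)) = A + B + Hf ∧
    #(A + Hf) + #(B + Hf) = #A + #B + #Hf + 2 ∧
    cosetCount H (A + B) + 1 = cosetCount H A + cosetCount H B ∧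
    (∃ α₁ ∈ A + Hf, ∃ b₁ ∈ B, α₁ ∉ A ∧ α₁ + b₁ = γ₁) ∧
    (∃ a₂ ∈ A, ∃ β₁ ∈ B + Hf, β₁ ∉ B ∧ a₂ + β₁ = γ₂) ∧
    (∀ α₁ β₁ : G, α₁ ∈ A + Hf → β₁ ∈ B + Hf → (∃ b₁ ∈ B, α₁ + b₁ = γ₁) → (∃ a₂ ∈ A, a₂ + β₁ = γ₂) →
      insert α₁ A + insert β₁ B = insert γ₁ (insert γ₂ (A + B))) := by
  classical
  set C := A + B with hC
  have hCne : C.Nonempty := hA.add hB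
  have hC'ne : (insert γ₁ (insert γ₂ C)).Nonempty := ⟨γ₁, mem_insert_self _ _⟩
  have h0Hf : (0 : G) ∈ Hf := (hHf 0).2 H.zero_mem
  have hHfper : IsPeriodicWith H Hf := fun h hh => vadd_finset_eq_of_forall_mem_iff hHf hh
  have hper : IsPeriodicWith H (insert γ₁ (insert γ₂ C)) := fun h hh => by
    have : h ∈ (insert γ₁ (insert γ₂ C)).addStab := by rw [hstab]; exact (hHf h).2 hh
    exact (mem_addStab hC'ne).1 this
  have hγ₁' : γ₁ ∉ insert γ₂ C := by rw [mem_insert, not_or]; exact ⟨hne, hγ₁⟩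
  have hcardC' : #(insert γ₁ (insert γ₂ C)) = #C + 2 := by
    rw [card_insert_of_notMem hγ₁', card_insert_of_notMem hγ₂]
  -- `C + Hf ⊆ C'`
  have hCH : C + Hf ⊆ insert γ₁ (insert γ₂ C) := by
    intro z hz
    obtain ⟨c, hc, h, hh, rfl⟩ := mem_add.1 hz
    have := hper.add_mem ((hHf h).1 hh) (mem_insert_of_mem (mem_insert_of_mem hc))
    rwa [add_comm] at this
  have h2Hf : 2 ≤ #Hf := by
    obtain ⟨g, hgH, hg0⟩ : ∃ g ∈ H, g ≠ (0 : G) := by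
      by_contra hno
      push Not at hno
      exact hH ((AddSubgroup.eq_bot_iff_forall _).2 hno)
    have : ({0, g} : Finset G) ⊆ Hf :=
      insert_subset h0Hf (singleton_subset_iff.2 ((hHf g).2 hgH))
    have := card_le_card this
    rwa [card_pair hg0.symm] at this
  -- (a) `γ ∈ C + Hf` for both new elements
  have key : ∀ γ γ' : G, γ ∉ C → γ' ∉ C →
      IsPeriodicWith H (insert γ (insert γ' C)) → γ ∈ C + Hf := by
    intro γ γ' hγ hγ' hperγ
    by_contra hγH
    have hsub : γ +ᵥ Hf ⊆ ({γ, γ'} : Finset G) := by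
      intro z hz
      obtain ⟨h, hh, rfl⟩ := mem_vadd_finset.1 hz
      have hz' : h + γ ∈ insert γ (insert γ' C) := hperγ.add_mem ((hHf h).1 hh) (mem_insert_self _ _)
      rw [vadd_eq_add, add_comm]
      rw [mem_insert, mem_insert] at hz'
      rcases hz' with h1 | h1 | h1
      · exact mem_insert.2 (Or.inl h1)
      · exact mem_insert_of_mem (mem_singleton.2 h1)
      · exfalso
        apply hγH
        refine mem_add.2 ⟨h + γ, h1, -h, (hHf _).2 (H.neg_mem ((hHf h).1 hh)), by abel⟩
    have heq : γ +ᵥ Hf = ({γ, γ'} : Finset G) := by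
      refine eq_of_subset_of_card_le hsub ?_
      rw [card_vadd_finset]
      exact (card_insert_le _ _).trans (by rw [card_singleton]; omega)
    have hγ'mem : γ' ∈ γ +ᵥ Hf := by rw [heq]; simp
    -- then `C = C' ∖ (γ + Hf)` is `H`-periodic
    have hCeq : C = insert γ (insert γ' C) \ (γ +ᵥ Hf) := by
      rw [heq]
      ext z
      simp only [mem_sdiff, mem_insert, mem_singleton, not_or]
      constructor
      · intro hz
        exact ⟨Or.inr (Or.inr hz), fun h => hγ (h ▸ hz), fun h => hγ' (h ▸ hz)⟩
      · rintro ⟨h | h | h, h1, h2⟩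
        · exact absurd h h1
        · exact absurd h h2
        · exact h
    have hCper : IsPeriodicWith H C := by
      intro h hh
      rw [hCeq, vadd_finset_sdiff, hperγ h hh, vadd_vadd, add_comm, ← vadd_vadd, hHfper h hh]
    exact (isPeriodic_iff_addStab_ne hCne).1 ⟨H, hH, hCper⟩ haper
  have hγ₁H : γ₁ ∈ C + Hf := key γ₁ γ₂ hγ₁ hγ₂ hper
  have hγ₂H : γ₂ ∈ C + Hf := key γ₂ γ₁ hγ₂ hγ₁ (by rw [Finset.insert_comm]; exact hper)
  have hC'eq : insert γ₁ (insert γ₂ C) = C + Hf := by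
    refine Subset.antisymm (fun z hz => ?_) hCH
    rw [mem_insert, mem_insert] at hz
    rcases hz with rfl | rfl | hz
    · exact hγ₁H
    · exact hγ₂H
    · exact subset_add_left C h0Hf hz
  -- (d) the elements `α₁`, `β₁`
  have hα : ∃ α₁ ∈ A + Hf, ∃ b₁ ∈ B, α₁ ∉ A ∧ α₁ + b₁ = γ₁ := by
    obtain ⟨c, hc, h, hh, hsum⟩ := mem_add.1 hγ₁H
    obtain ⟨a, ha, b, hb, rfl⟩ := mem_add.1 hc
    refine ⟨a + h, add_mem_add ha hh, b, hb, fun hmem => hγ₁ ?_, by rw [← hsum]; abel⟩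
    have : a + h + b ∈ A + B := add_mem_add hmem hb
    rwa [show a + h + b = a + b + h by abel, hsum] at this
  have hβ : ∃ a₂ ∈ A, ∃ β₁ ∈ B + Hf, β₁ ∉ B ∧ a₂ + β₁ = γ₂ := by
    obtain ⟨c, hc, h, hh, hsum⟩ := mem_add.1 hγ₂H
    obtain ⟨a, ha, b, hb, rfl⟩ := mem_add.1 hc
    refine ⟨a, ha, b + h, add_mem_add hb hh, fun hmem => hγ₂ ?_, by rw [← hsum]; abel⟩
    have : a + (b + h) ∈ A + B := add_mem_add ha hmem
    rwa [show a + (b + h) = a + b + h by abel, hsum] at this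
  have hsumEq : ∀ α₁ β₁ : G, α₁ ∈ A + Hf → β₁ ∈ B + Hf → (∃ b₁ ∈ B, α₁ + b₁ = γ₁) →
      (∃ a₂ ∈ A, a₂ + β₁ = γ₂) → insert α₁ A + insert β₁ B = insert γ₁ (insert γ₂ C) := by
    intro α₁ β₁ hα₁ hβ₁ h₁ h₂
    obtain ⟨b₁, hb₁, hγ₁eq⟩ := h₁
    obtain ⟨a₂, ha₂, hγ₂eq⟩ := h₂
    refine Subset.antisymm ?_ ?_
    · -- `⊆ (A + H) + (B + H) = C + H = C'`
      intro z hz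
      obtain ⟨x, hx, y, hy, rfl⟩ := mem_add.1 hz
      have hx' : x ∈ A + Hf := by
        rw [mem_insert] at hx
        rcases hx with rfl | hx
        · exact hα₁
        · exact subset_add_left A h0Hf hx
      have hy' : y ∈ B + Hf := by
        rw [mem_insert] at hy
        rcases hy with rfl | hy
        · exact hβ₁
        · exact subset_add_left B h0Hf hy
      have hxy : x + y ∈ (A + Hf) + (B + Hf) := add_mem_add hx' hy'
      have hper2 : (A + Hf) + (B + Hf) = C + Hf := by
        rw [add_add_add_comm, (isPeriodicWith_iff_add_eq hHf).1 hHfper]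
      rw [hper2, ← hC'eq] at hxy
      exact hxy
    · intro z hz
      rw [mem_insert, mem_insert] at hz
      rcases hz with rfl | rfl | hz
      · rw [← hγ₁eq]; exact add_mem_add (mem_insert_self _ _) (mem_insert_of_mem hb₁)
      · rw [← hγ₂eq]; exact add_mem_add (mem_insert_of_mem ha₂) (mem_insert_self _ _)
      · exact add_subset_add (subset_insert _ _) (subset_insert _ _) hz
  -- (b), (c): Kneser for `(A + H, B)` and counting
  have hAHper : IsPeriodicWith H (A + Hf) := isPeriodicWith_add_of_forall_mem_iff hHf A
  have hBHper : IsPeriodicWith H (B + Hf) := isPeriodicWith_add_of_forall_mem_iff hHf B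
  have hX : A + Hf + Hf = A + Hf := (isPeriodicWith_iff_add_eq hHf).1 hAHper
  have hsumX : A + Hf + B = insert γ₁ (insert γ₂ C) := by rw [add_right_comm, ← hC'eq]
  have hkn := add_kneser (A + Hf) B
  rw [hsumX, hstab, hX] at hkn
  have hcA : #(A + Hf) = cosetCount H A * #Hf := by
    rw [card_eq_cosetCount_mul hHf hAHper, cosetCount_add_carrier hHf]
  have hcB : #(B + Hf) = cosetCount H B * #Hf := by
    rw [card_eq_cosetCount_mul hHf hBHper, cosetCount_add_carrier hHf]
  have hcC : #(insert γ₁ (insert γ₂ C)) = cosetCount H C * #Hf := by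
    rw [hC'eq, card_eq_cosetCount_mul hHf (isPeriodicWith_add_of_forall_mem_iff hHf C),
      cosetCount_add_carrier hHf]
  have hpos : 0 < #Hf := by omega
  have hle : cosetCount H A + cosetCount H B ≤ cosetCount H C + 1 := by
    apply Nat.le_of_mul_le_mul_right _ hpos
    rw [add_mul, add_mul, one_mul, ← hcA, ← hcB, ← hcC]
    exact hkn
  have hAsub : #A ≤ #(A + Hf) := card_le_card (subset_add_left A h0Hf)
  have hBsub : #B ≤ #(B + Hf) := card_le_card (subset_add_left B h0Hf)
  rcases Nat.lt_or_ge (cosetCount H A + cosetCount H B) (cosetCount H C + 1) with hlt | hge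
  · -- strict inequality: at most two holes in total — impossible
    exfalso
    have hle' : cosetCount H A + cosetCount H B ≤ cosetCount H C := by omega
    have hmul := Nat.mul_le_mul_right (#Hf) hle'
    rw [add_mul, ← hcA, ← hcB, ← hcC, hcardC', hC, hAB] at hmul
    -- `hmul : #(A + Hf) + #(B + Hf) ≤ #A + #B + 2`
    -- no hole in `A` (or `B`) makes `A + B` periodic
    have holeA : #A < #(A + Hf) := by
      by_contra hnot
      have heqA : A = A + Hf := eq_of_subset_of_card_le (subset_add_left A h0Hf) (not_lt.1 hnot)
      exact (isPeriodic_iff_addStab_ne hCne).1 ⟨H, hH, by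
        have e : C = A + Hf + B := by rw [hC, ← heqA]
        rw [e]; exact hAHper.add_right B⟩ haper
    have holeB : #B < #(B + Hf) := by
      by_contra hnot
      have heqB : B = B + Hf := eq_of_subset_of_card_le (subset_add_left B h0Hf) (not_lt.1 hnot)
      exact (isPeriodic_iff_addStab_ne hCne).1 ⟨H, hH, by
        have e : C = A + (B + Hf) := by rw [hC, ← heqB]
        rw [e]; exact hBHper.add_left A⟩ haper
    -- exactly one hole each: both sets lie in one coset, so `C` does, but `|φ(A)| + |φ(B)| = |φ(C)| ≥ …`
    have h1A : #(A + Hf) = #A + 1 := by omega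
    have h1B : #(B + Hf) = #B + 1 := by omega
    have hAc := sub_mem_of_card_add_eq_succ hHf hH hAqp h1A
    have hBc := sub_mem_of_card_add_eq_succ hHf hH hBqp h1B
    have hcA1 : cosetCount H A = 1 := cosetCount_eq_one_of_sub_mem hA hAc
    have hcB1 : cosetCount H B = 1 := cosetCount_eq_one_of_sub_mem hB hBc
    have hcC1 : cosetCount H C = 1 := by
      refine cosetCount_eq_one_of_sub_mem hCne fun x hx y hy => ?_
      obtain ⟨a, ha, b, hb, rfl⟩ := mem_add.1 hx
      obtain ⟨a', ha', b', hb', rfl⟩ := mem_add.1 hy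
      rw [add_sub_add_comm]
      exact H.add_mem (hAc a ha a' ha') (hBc b hb b' hb')
    omega
  · -- equality: (c) and then (b) by counting
    have hii : cosetCount H C + 1 = cosetCount H A + cosetCount H B := by omega
    refine ⟨hC'eq, ?_, hii, hα, hβ, hsumEq⟩
    have := congrArg (· * #Hf) hii
    simp only [add_mul, one_mul] at this
    rw [← hcA, ← hcB, ← hcC, hcardC', hC, hAB] at this
    omega

end Grynkiewicz2009

end Literature.Combinatorics.Additive
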